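import Mathlib
import Summits.Ventures.PercRepro2.HCov
import Summits.Ventures.PercRepro2.EdgeCubic
import Summits.Ventures.PercRepro2.KPrimePendantLemmas
import Summits.Ventures.PercRepro2.FirstOrderTerms
import Summits.Ventures.PercRepro2.FirstOrderPendantClosed
import Summits.Ventures.PercRepro2.FirstOrderRoot

/-!
# The dictionary `B1 = 2·Φ` at a pendant root edge, and `B1 ≥ 0` there (blind cell PercRepro2, p5 g21;
`proofs/P5-OEDGE.md` §27)

Let the root `a₂` be a LEAF: its only edge is `e = {a₂, z}`.  At the closed pin `p[e↦0]` the root is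
isolated, so every `C₂`-mass vanishes, `P(Q) = 1`, `T = ∅`, `PD = {a₃ ∉ C₁}`, `T′ = {a₃ ∈ C₁}`
(`closed_*`), and `Gc₀ = 0`.  The one-copy Bernstein coefficient `EdgeLine.B1` of the root edge is then
exactly twice the first-order functional `Φ` of `FirstOrderTerms.lean`, evaluated at the open pin with
`z := a₂` (**`B1_eq_two_Phi`**: the three closed-pin scalars `β, D₀, D_o⁰` of `Φ` are flip-invariant
(`KPrime.flipInvAt_*`), the open-pin events of `Φ` are the world masses `T′ ∩ oH ∩ bH`, `(PD ⊔ T′) ∩ oH`,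
`(PD ⊔ T) ∩ bH`, `T ∩ …`; then `ring`).  With `Phi_nonneg`:

**`B1_nonneg_pendant_root`**: `0 ≤ B1` at every pendant root edge — the first-order (HCOV) in the
tree's Bernstein vocabulary (row 2′CPOLAR's one-copy coefficient at the pendant root edges is a
THEOREM).
-/

namespace Summit.Ventures.PercRepro2

open UnionCluster

namespace CovForm

namespace FirstOrder


section Dictionary

variable {V : Type*} {E : Type*} [Fintype E] [DecidableEq E] [Fintype V] [DecidableEq V]
  {R : Type*} [Field R] [LinearOrder R] [IsStrictOrderedRing R]
variable {ends : E → Sym2 V} {p : E → R} {e : E} {a₂ z : V}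

omit [Fintype E] [DecidableEq E] [Fintype V] [DecidableEq V] [LinearOrder R] [IsStrictOrderedRing R] in
/-- `PDEvent` is symmetric in the two roots. -/
lemma PDEvent_comm (ends : E → Sym2 V) (a₁ a₂ a₃ : V) :
    PDEvent ends a₂ a₁ a₃ = PDEvent ends a₁ a₂ a₃ := by
  ext ω
  simp only [PDEvent, Dtilde, inU, Set.mem_inter_iff, Set.mem_compl_iff, Set.mem_union,
    mem_connEvent, not_or]
  have h12 : Conn ends ω a₂ a₁ ↔ Conn ends ω a₁ a₂ := ⟨conn_symm, conn_symm⟩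
  tauto

omit [Fintype E] [DecidableEq E] [Fintype V] [DecidableEq V] [LinearOrder R] [IsStrictOrderedRing R] in
/-- The `Afo`-event is `T′ ∩ {o ∈ C₂} ∩ {b ∈ C₂}`. -/
lemma Afo_event_eq (ends : E → Sym2 V) (o a₁ a₂ a₃ b : V) :
    avoidAll ends a₁ {a₂} ∩ connEvent ends a₁ a₃ ∩ connEvent ends a₂ b ∩ connEvent ends a₂ o =
      TEvent ends a₂ a₁ a₃ ∩ (connEvent ends a₂ o ∩ connEvent ends a₂ b) := by
  ext ω
  simp only [TEvent, avoidAll, Set.mem_inter_iff, Set.mem_compl_iff, mem_connEvent,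
    Set.mem_setOf_eq, Finset.mem_singleton, forall_eq]
  tauto

omit [Fintype E] [DecidableEq E] [Fintype V] [DecidableEq V] [LinearOrder R] [IsStrictOrderedRing R] in
/-- The `Dfo`-events are `T ∩ …`. -/
lemma Dfo_event_eq (ends : E → Sym2 V) (a₁ a₂ a₃ : V) (X : Set (Config E)) :
    avoidAll ends a₃ {a₁} ∩ connEvent ends a₃ a₂ ∩ X = TEvent ends a₁ a₂ a₃ ∩ X := by
  ext ω
  simp only [TEvent, avoidAll, Set.mem_inter_iff, Set.mem_compl_iff, mem_connEvent,
    Set.mem_setOf_eq, Finset.mem_singleton, forall_eq]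
  constructor
  · rintro ⟨⟨h31, h32⟩, hX⟩
    exact ⟨⟨fun h21 => h31 (conn_trans h32 h21), conn_symm h32⟩, hX⟩
  · rintro ⟨⟨h21, h23⟩, hX⟩
    exact ⟨⟨fun h31 => h21 (conn_trans h23 h31), conn_symm h23⟩, hX⟩


omit [Fintype V] [LinearOrder R] [IsStrictOrderedRing R] in
/-- `E_Q[σ_b σ_o]` in world masses. -/
lemma open_EQbo (q : E → R) (ends : E → Sym2 V) (o a₁ a₂ a₃ b : V) :
    EQbo q ends o a₁ a₂ b =
      prob q (PDEvent ends a₁ a₂ a₃ ∩ (connEvent ends a₁ o ∩ connEvent ends a₁ b)) +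
        prob q (TEvent ends a₁ a₂ a₃ ∩ (connEvent ends a₁ o ∩ connEvent ends a₁ b)) +
        prob q (TEvent ends a₂ a₁ a₃ ∩ (connEvent ends a₁ o ∩ connEvent ends a₁ b)) +
      (prob q (PDEvent ends a₁ a₂ a₃ ∩ (connEvent ends a₂ o ∩ connEvent ends a₂ b)) +
        prob q (TEvent ends a₁ a₂ a₃ ∩ (connEvent ends a₂ o ∩ connEvent ends a₂ b)) +
        prob q (TEvent ends a₂ a₁ a₃ ∩ (connEvent ends a₂ o ∩ connEvent ends a₂ b))) -
      (prob q (PDEvent ends a₁ a₂ a₃ ∩ (connEvent ends a₂ o ∩ connEvent ends a₁ b)) +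
        prob q (TEvent ends a₁ a₂ a₃ ∩ (connEvent ends a₂ o ∩ connEvent ends a₁ b)) +
        prob q (TEvent ends a₂ a₁ a₃ ∩ (connEvent ends a₂ o ∩ connEvent ends a₁ b))) -
      (prob q (PDEvent ends a₁ a₂ a₃ ∩ (connEvent ends a₁ o ∩ connEvent ends a₂ b)) +
        prob q (TEvent ends a₁ a₂ a₃ ∩ (connEvent ends a₁ o ∩ connEvent ends a₂ b)) +
        prob q (TEvent ends a₂ a₁ a₃ ∩ (connEvent ends a₁ o ∩ connEvent ends a₂ b))) := by
  unfold EQbo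
  rw [Qsplit q ends a₁ a₂ a₃, Qsplit q ends a₁ a₂ a₃, Qsplit q ends a₁ a₂ a₃, Qsplit q ends a₁ a₂ a₃]

omit [Fintype V] [LinearOrder R] [IsStrictOrderedRing R] in
/-- `E_Q[σ_o]` in world masses. -/
lemma open_EQo (q : E → R) (ends : E → Sym2 V) (o a₁ a₂ a₃ : V) :
    EQo q ends o a₁ a₂ =
      prob q (PDEvent ends a₁ a₂ a₃ ∩ connEvent ends a₁ o) +
        prob q (TEvent ends a₁ a₂ a₃ ∩ connEvent ends a₁ o) +
        prob q (TEvent ends a₂ a₁ a₃ ∩ connEvent ends a₁ o) -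
      (prob q (PDEvent ends a₁ a₂ a₃ ∩ connEvent ends a₂ o) +
        prob q (TEvent ends a₁ a₂ a₃ ∩ connEvent ends a₂ o) +
        prob q (TEvent ends a₂ a₁ a₃ ∩ connEvent ends a₂ o)) := by
  unfold EQo
  rw [Qsplit q ends a₁ a₂ a₃, Qsplit q ends a₁ a₂ a₃]

omit [Fintype V] in
/-- `gap` in world masses. -/
lemma open_gap (q : E → R) (ends : E → Sym2 V) (a₁ a₂ a₃ b : V) :
    gap q ends a₁ a₂ b =
      prob q (PDEvent ends a₁ a₂ a₃ ∩ connEvent ends a₂ b) +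
        prob q (TEvent ends a₁ a₂ a₃ ∩ connEvent ends a₂ b) +
        prob q (TEvent ends a₂ a₁ a₃ ∩ connEvent ends a₂ b) -
      (prob q (PDEvent ends a₁ a₂ a₃ ∩ connEvent ends a₁ b) +
        prob q (TEvent ends a₁ a₂ a₃ ∩ connEvent ends a₁ b) +
        prob q (TEvent ends a₂ a₁ a₃ ∩ connEvent ends a₁ b)) := by
  rw [gap_eq_Q, Qsplit q ends a₁ a₂ a₃, Qsplit q ends a₁ a₂ a₃]

omit [Fintype V] in
/-- **The dictionary**: at a pendant root edge `e = {a₂, z}` (the only edge at `a₂`), the one-copy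
Bernstein coefficient of `Gc` along `e` is twice the first-order functional at the open pin with
`z := a₂`. -/
theorem B1_eq_two_Phi (he : p e ≠ 1) (hleaf : ∀ f, a₂ ∈ ends f → f = e)
    (hends : ends e = s(a₂, z)) {o a₁ a₃ b : V} (ho : o ≠ a₂) (h1 : a₁ ≠ a₂) (h3 : a₃ ≠ a₂)
    (hb : b ≠ a₂) :
    EdgeLine.B1 p ends o a₁ a₂ a₃ b e = 2 * Phi (Function.update p e 1) ends o a₁ a₃ b a₂ := by
  -- the three closed-pin scalars of `Φ` (flip invariance at the pendant edge)
  have fβ : prob (Function.update p e 1) (connEvent ends a₁ b) =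
      prob (Function.update p e 0) (connEvent ends a₁ b) :=
    KPrime.prob_update_one_eq_update_zero_of_flipInvAt he
      (KPrime.flipInvAt_connEvent hleaf hends h1 hb)
  have fD : prob (Function.update p e 1) (avoidAll ends a₁ {a₃}) =
      prob (Function.update p e 0) (avoidAll ends a₁ {a₃}) :=
    KPrime.prob_update_one_eq_update_zero_of_flipInvAt he
      (KPrime.flipInvAt_avoidAll hleaf hends h1 (fun x hx => by
        rw [Finset.mem_singleton] at hx; rw [hx]; exact h3))
  have fDo : prob (Function.update p e 1) (avoidAll ends a₁ {a₃} ∩ connEvent ends a₁ o) =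
      prob (Function.update p e 0) (avoidAll ends a₁ {a₃} ∩ connEvent ends a₁ o) :=
    KPrime.prob_update_one_eq_update_zero_of_flipInvAt he
      ((KPrime.flipInvAt_avoidAll hleaf hends h1 (fun x hx => by
        rw [Finset.mem_singleton] at hx; rw [hx]; exact h3)).inter
        (KPrime.flipInvAt_connEvent hleaf hends h1 ho))
  -- the open-pin events of `Φ` as world masses
  have eA := Afo_event_eq ends o a₁ a₂ a₃ b
  have eB1 := ISplit.prob_PD_add_T (Function.update p e 1) ends a₂ a₁ a₃ (connEvent ends a₂ o)
  have eB2 := ISplit.prob_PD_add_T (Function.update p e 1) ends a₂ a₁ a₃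
    (connEvent ends a₂ o ∩ connEvent ends a₁ b)
  rw [PDEvent_comm] at eB1 eB2
  have eC1 := ISplit.prob_PD_add_T (Function.update p e 1) ends a₁ a₂ a₃ (connEvent ends a₂ b)
  have eC2 := ISplit.prob_PD_add_T (Function.update p e 1) ends a₁ a₂ a₃
    (connEvent ends a₁ o ∩ connEvent ends a₂ b)
  have eB2' : avoidAll ends a₂ {a₁, a₃} ∩ connEvent ends a₂ o ∩ connEvent ends a₁ b =
      avoidAll ends a₂ {a₁, a₃} ∩ (connEvent ends a₂ o ∩ connEvent ends a₁ b) := Set.inter_assoc _ _ _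
  have eC2' : avoidAll ends a₁ {a₂, a₃} ∩ connEvent ends a₂ b ∩ connEvent ends a₁ o =
      avoidAll ends a₁ {a₂, a₃} ∩ (connEvent ends a₁ o ∩ connEvent ends a₂ b) := by
    ext ω; simp only [Set.mem_inter_iff]; tauto
  have eD1 := Dfo_event_eq ends a₁ a₂ a₃ (connEvent ends a₁ b ∩ connEvent ends a₁ o)
  have eD2 := Dfo_event_eq ends a₁ a₂ a₃ (connEvent ends a₁ o)
  have eD3 := Dfo_event_eq ends a₁ a₂ a₃ (connEvent ends a₁ b)
  have eD4 := Dfo_event_eq ends a₁ a₂ a₃ Set.univ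
  rw [Set.inter_univ, Set.inter_univ] at eD4
  have eD1' : avoidAll ends a₃ {a₁} ∩ connEvent ends a₃ a₂ ∩ connEvent ends a₁ b ∩ connEvent ends a₁ o =
      avoidAll ends a₃ {a₁} ∩ connEvent ends a₃ a₂ ∩ (connEvent ends a₁ b ∩ connEvent ends a₁ o) :=
    Set.inter_assoc _ _ _
  have eD1'' : TEvent ends a₁ a₂ a₃ ∩ (connEvent ends a₁ b ∩ connEvent ends a₁ o) =
      TEvent ends a₁ a₂ a₃ ∩ (connEvent ends a₁ o ∩ connEvent ends a₁ b) := by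
    rw [Set.inter_comm (connEvent ends a₁ b)]
  -- assemble
  unfold EdgeLine.B1
  rw [closed_Q hleaf h1, closed_PD hleaf h1 h3, closed_Do hleaf ho h1 h3, closed_EQbo hleaf ho h1 hb a₃,
    closed_EQb3 hleaf h1 h3 hb, closed_EQb3o hleaf ho h1 h3 hb, closed_EQo hleaf ho h1 a₃,
    closed_EQ3 hleaf h1 h3, closed_EQ3o hleaf ho h1 h3, closed_PDb hleaf h1 h3 hb,
    closed_PDbo hleaf ho h1 h3 hb, closed_gap hleaf h1 hb a₃]
  unfold Phi Afo Bfo Cfo Dfo beta D0 Do0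
  rw [fβ, fD, fDo, eA, eB2', ← eB1, ← eB2, eC2', ← eC1, ← eC2, eD1', eD1, eD1'', eD2, eD3, eD4,
    split_a₃ (Function.update p e 0) a₁ a₃ (connEvent ends a₁ b)]
  rw [Qsplit_univ (Function.update p e 1) ends a₁ a₂ a₃,
    open_EQbo (Function.update p e 1) ends o a₁ a₂ a₃ b, open_EQo (Function.update p e 1) ends o a₁ a₂ a₃,
    open_gap (Function.update p e 1) ends a₁ a₂ a₃ b]
  delta EdgeLine.B1Poly EdgeLine.polar1 EQb3 EQb3o EQ3 EQ3o PDb PDbo Do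
  ring1

/-- **`B1 ≥ 0` at every pendant root edge**: the first-order (HCOV) in the tree's vocabulary. -/
theorem B1_nonneg_pendant_root (hp : IsProbVec p) (he : p e ≠ 1) (hleaf : ∀ f, a₂ ∈ ends f → f = e)
    (hends : ends e = s(a₂, z)) {o a₁ a₃ b : V} (ho : o ≠ a₂) (h1 : a₁ ≠ a₂) (h3 : a₃ ≠ a₂)
    (hb : b ≠ a₂) :
    0 ≤ EdgeLine.B1 p ends o a₁ a₂ a₃ b e := by
  rw [B1_eq_two_Phi he hleaf hends ho h1 h3 hb]
  have hp₁ : IsProbVec (Function.update p e 1) := hp.update e zero_le_one le_rfl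
  have := Phi_nonneg (Function.update p e 1) hp₁ ends o a₁ a₃ b a₂
  linarith

end Dictionary

end FirstOrder

end CovForm

end Summit.Ventures.PercRepro2
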